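import Literature.Computability.AlgebraicComplexity.PaddedPowerSums
import HarnessLib

/-!
# The padded determinant `X₀₀^{m-n} · det_n` and its membership in `End · det_m ⊆ \overline{GL_{m²}·det_m}`

Topic `Literature/Computability/AlgebraicComplexity`; a small DEFINITION file (cell `pub-gct-max`, track F/T),
companion of the tree's padded permanent `paddedPerPoly k n m = X₀₀^{m-n}·per_n` (`OrbitClosure.lean`): the same
padding applied to the DETERMINANT, `paddedDetPoly k n m = X₀₀^{m-n}·det_n(bottom-right block)`, which is the
standard CONTROL object when a rank method is tested against `\overline{GL_{m²}·det_m}` — Efremenko–Landsberg–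
Schenck–Weyman compare the padded permanent with degenerations `R ∈ End(W)·det_n` of exactly this block form
("Block the matrix ... fill the remainder of the diagonal with `ℓ` ... and fill the remainder of the matrix with
zeros. Let `R` be the restriction of the determinant to this subspace", §3, Case C1) [cite:
EfremenkoLandsbergSchenckWeyman2018, §3 (Case C1)]; the cell's engine-3 uses `z^{n-3}·det₃ = det_n(diag(z·I, X))`
as the control for its Koszul–Young certificates.

**What is here.** `paddedDetPoly` (definition, junk for `n > m` exactly as `paddedPerPoly`);
`paddedDetPoly_isHomogeneous`; `paddedDetMatrix` — the `m × m` matrix of linear forms `diag(X₀₀,…,X₀₀) ⊕ (X_{ij})`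
(block form) — and **`det_paddedDetMatrix : (paddedDetMatrix k n m).det = paddedDetPoly k n m`** (block-triangular
determinant); hence **`paddedDetPoly_mem_endOrbit_detPoly : X₀₀^{m-n}·det_n ∈ End·det_m`** (the tree's
`det_mem_endOrbit_detPoly`: the determinant of a matrix of linear forms is a linear substitution instance of
`det_m`, BIP 2019 proof of Thm. 2.5) and `paddedDetPoly_mem_orbitClosure_detPoly : X₀₀^{m-n}·det_n ∈
\overline{GL_{m²}·det_m}` over an infinite field (`endOrbit_subset_orbitClosure_holds`). Everything is a
definition or proved; no named facts.

## References
* [EfremenkoLandsbergSchenckWeyman2018] K. Efremenko, J. M. Landsberg, H. Schenck, J. Weyman, *The method of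
  shifted partial derivatives cannot separate the permanent from the determinant*, Math. Comp. 87 (2018), §1.1
  (`End(W)·det_n`), §3 Case C1 (block-diagonal restrictions of `det_n`).
* [BurgisserIkenmeyerPanovaJAMS2019] P. Bürgisser, C. Ikenmeyer, G. Panova, *No occurrence obstructions in
  geometric complexity theory*, J. AMS 32 (2019), §1 (padding), proof of Thm. 2.5 (determinants of matrices of
  linear forms lie in `Ω_n`).
* [MulmuleySohoni2001] K. Mulmuley, M. Sohoni, *GCT I*, SIAM J. Comput. 31 (2001), §4.
-/

noncomputable section

open MvPolynomial

namespace Literature.Computability.AlgebraicComplexity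

section Padded

variable (k : Type*) [Field k]

/-- The **padded `n × n` determinant** `X₀₀ ^ (m - n) · det_n` as a degree-`m` form in the `m²` variables of the
generic `m × m` matrix: `det_n` is the determinant of the bottom-right `n × n` block (indices `BlockIdx n m`) and
the padding variable is the `(0,0)` entry — the rendering of the tree's `paddedPerPoly` with `per ↦ det`. It is
the restriction of `det_m` to the block subspace `diag(X₀₀,…,X₀₀) ⊕ (n × n block)` of ELSW's Case C1 (with one
block), see `det_paddedDetMatrix`. Junk for `n > m` (then it is `det_m`), as for `paddedPerPoly`.
[cite: EfremenkoLandsbergSchenckWeyman2018, §3 (Case C1: "fill the remainder of the diagonal with `ℓ` ... Let `R` be the restriction of the determinant to this subspace")] -/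
def paddedDetPoly (n m : ℕ) [NeZero m] : MvPolynomial (Fin m × Fin m) k :=
  X (0, 0) ^ (m - n) *
    rename (fun ij : BlockIdx n m × BlockIdx n m => ((ij.1 : Fin m), (ij.2 : Fin m)))
      (detPoly (BlockIdx n m) k)

/-- The `m × m` matrix of linear forms whose determinant is the padded determinant: `X_{ij}` on the bottom-right
`n × n` block, `X₀₀` on the remaining diagonal, `0` elsewhere (ELSW Case C1 with one block).
[cite: EfremenkoLandsbergSchenckWeyman2018, §3 (Case C1)] -/
def paddedDetMatrix (n m : ℕ) [NeZero m] : Matrix (Fin m) (Fin m) (MvPolynomial (Fin m × Fin m) k) :=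
  Matrix.of fun i j =>
    if m - n ≤ (i : ℕ) ∧ m - n ≤ (j : ℕ) then X (i, j) else if i = j then X (0, 0) else 0

variable {k}

/-- Unfolding lemma for `paddedDetMatrix`. [cite: EfremenkoLandsbergSchenckWeyman2018, §3 (Case C1)] -/
theorem paddedDetMatrix_apply (n m : ℕ) [NeZero m] (i j : Fin m) :
    paddedDetMatrix k n m i j =
      if m - n ≤ (i : ℕ) ∧ m - n ≤ (j : ℕ) then X (i, j) else if i = j then X (0, 0) else 0 := rfl

/-- For `n ≤ m` the padded determinant is a form of degree `m` (as `paddedPerPoly_isHomogeneous`).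
[cite: EfremenkoLandsbergSchenckWeyman2018, §1.1 (`ℓ^{n-m} perm_m ∈ S^nW`; here with `det`)] -/
theorem paddedDetPoly_isHomogeneous {n m : ℕ} [NeZero m] (h : n ≤ m) :
    (paddedDetPoly k n m).IsHomogeneous m := by
  have h1 := isHomogeneous_X_pow (R := k) ((0 : Fin m), (0 : Fin m)) (m - n)
  have h2 := (detPoly_isHomogeneous (n := BlockIdx n m) (k := k)).rename_isHomogeneous
    (f := fun ij : BlockIdx n m × BlockIdx n m => ((ij.1 : Fin m), (ij.2 : Fin m)))
  rw [card_blockIdx h] at h2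
  have := h1.mul h2
  rwa [Nat.sub_add_cancel h] at this

/-- The entries of `paddedDetMatrix` are linear forms. [cite: EfremenkoLandsbergSchenckWeyman2018, §3 (Case C1)] -/
theorem paddedDetMatrix_isHomogeneous (n m : ℕ) [NeZero m] (i j : Fin m) :
    (paddedDetMatrix k n m i j).IsHomogeneous 1 := by
  rw [paddedDetMatrix_apply]
  split_ifs
  · exact isHomogeneous_X k _
  · exact isHomogeneous_X k _
  · exact isHomogeneous_zero _ _ _

/-- **Block-triangular determinant**: `det (paddedDetMatrix) = X₀₀^{m-n} · det_n(block) = paddedDetPoly k n m`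
(ELSW Case C1: the restriction of `det` to the block subspace). [cite: EfremenkoLandsbergSchenckWeyman2018, §3 (Case C1)] -/
theorem det_paddedDetMatrix (n m : ℕ) [NeZero m] :
    (paddedDetMatrix k n m).det = paddedDetPoly k n m := by
  classical
  -- block-triangular with respect to the block predicate `p i := m - n ≤ i`
  rw [Matrix.twoBlockTriangular_det (paddedDetMatrix k n m) (fun i : Fin m => m - n ≤ (i : ℕ))]
  swap
  · intro i hi j hj
    rw [paddedDetMatrix_apply, if_neg (fun h => hi h.1), if_neg]
    rintro rfl
    exact hi hj
  -- the block: the generic `n × n` determinant, renamed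
  have hblock : (Matrix.toSquareBlockProp (paddedDetMatrix k n m) (fun i : Fin m => m - n ≤ (i : ℕ))).det =
      rename (fun ij : BlockIdx n m × BlockIdx n m => ((ij.1 : Fin m), (ij.2 : Fin m)))
        (detPoly (BlockIdx n m) k) := by
    rw [detPoly, AlgHom.map_det, AlgHom.mapMatrix_apply]
    congr 1
    ext i j
    rw [Matrix.toSquareBlockProp_def, Matrix.of_apply, paddedDetMatrix_apply, if_pos ⟨i.2, j.2⟩,
      Matrix.map_apply, Matrix.mvPolynomialX_apply, rename_X]
  -- the complement: `X₀₀` times the identity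
  have hcompl : (Matrix.toSquareBlockProp (paddedDetMatrix k n m) (fun i : Fin m => ¬ m - n ≤ (i : ℕ))).det =
      X (0, 0) ^ (m - n) := by
    have hmat : Matrix.toSquareBlockProp (paddedDetMatrix k n m) (fun i : Fin m => ¬ m - n ≤ (i : ℕ)) =
        (X ((0 : Fin m), (0 : Fin m)) : MvPolynomial (Fin m × Fin m) k) •
          (1 : Matrix {a : Fin m // ¬ m - n ≤ (a : ℕ)} {a : Fin m // ¬ m - n ≤ (a : ℕ)}
            (MvPolynomial (Fin m × Fin m) k)) := by
      ext i j
      rw [Matrix.toSquareBlockProp_def, Matrix.of_apply, paddedDetMatrix_apply, if_neg (fun h => i.2 h.1),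
        Matrix.smul_apply, Matrix.one_apply, smul_eq_mul, mul_ite, mul_one, mul_zero]
      by_cases hij : i = j
      · rw [if_pos (congrArg Subtype.val hij), if_pos hij]
      · rw [if_neg (fun h => hij (Subtype.ext h)), if_neg hij]
    rw [hmat, Matrix.det_smul, Matrix.det_one, mul_one, Fintype.card_subtype_compl, Fintype.card_fin]
    congr 1
    -- `#{i < m | m - n ≤ i} = m - (m - n)` hence the complement has `m - n` elements
    have hcard : Fintype.card {a : Fin m // m - n ≤ (a : ℕ)} = m - (m - n) := by
      rw [Fintype.card_subtype]
      have : (Finset.univ.filter fun a : Fin m => m - n ≤ (a : ℕ)) =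
          (Finset.univ.filter fun j : Fin m => (j : ℕ) < m - (m - n)).map
            ⟨fun j => Fin.rev j, Fin.rev_injective⟩ := by
        ext i
        simp only [Finset.mem_filter, Finset.mem_univ, true_and, Finset.mem_map, Function.Embedding.coeFn_mk]
        constructor
        · intro hi
          refine ⟨i.rev, ?_, Fin.rev_rev i⟩
          rw [Fin.val_rev]; omega
        · rintro ⟨j, hj, rfl⟩
          rw [Fin.val_rev]; omega
      rw [this, Finset.card_map, Fin.card_filter_val_lt]
      omega
    rw [hcard]
    omega
  rw [hblock, hcompl, paddedDetPoly, mul_comm]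

/-- **The padded determinant is a linear substitution instance of `det_m`**:
`X₀₀^{m-n} · det_n ∈ End(k^{m²}) · det_m` (a matrix of linear forms; BIP's remark in the proof of Thm. 2.5 that
determinants of matrices of linear forms are instances of `det`, tree `det_mem_endOrbit_detPoly`; ELSW's
`R ∈ End(W)·det_n`). [cite: EfremenkoLandsbergSchenckWeyman2018, §3 (Case C1: `R ∈ End(W)·det_n`)]
[cite: BurgisserIkenmeyerPanovaJAMS2019, Thm. 2.5 (proof)] -/
theorem paddedDetPoly_mem_endOrbit_detPoly (n m : ℕ) [NeZero m] :
    paddedDetPoly k n m ∈ endOrbit (Fin m × Fin m) k (detPoly (Fin m) k) := by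
  rw [← det_paddedDetMatrix]
  exact det_mem_endOrbit_detPoly _ (paddedDetMatrix_isHomogeneous n m)

/-- Over an infinite field: `X₀₀^{m-n} · det_n ∈ \overline{GL_{m²} · det_m}` (`End · det_m ⊆ Ω_m`, tree
`endOrbit_subset_orbitClosure_holds`). [cite: EfremenkoLandsbergSchenckWeyman2018, §1.1 and §3 (Case C1)]
[cite: MulmuleySohoni2001, §4] -/
theorem paddedDetPoly_mem_orbitClosure_detPoly [Infinite k] (n m : ℕ) [NeZero m] :
    paddedDetPoly k n m ∈ orbitClosure (detPoly (Fin m) k) :=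
  endOrbit_subset_orbitClosure_holds _ (paddedDetPoly_mem_endOrbit_detPoly n m)

end Padded

end Literature.Computability.AlgebraicComplexity
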